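/-
Copyright (c) 2026. Released under Apache 2.0 license as described in the file LICENSE.
Track B ∕ K2-LIT (cell `hodgecm-mathlib`, squad K2, ENGINE E1), crux h413 = `stmt-HodgeConjecture-24833`, route of record `HCCMUnconditional`.
Prover seat `hodgecm-mathlib-K2E3-p12` (g7).  Deal «P8 prep» (K2E1-plan (g5) 08:56:01Z, «=» 09:04:59Z), file G-b: Bernstein–Lapid's auxiliary system and the per-ball assembly (abstract letters).
-/
import Summits.HodgeConjecture.HodgeConjecture.Theorems.K2E1BLMeromorphicGluing          -- ★ G-a (this seat): `meromorphicOn_scalarisation`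
import Summits.HodgeConjecture.HodgeConjecture.Theorems.K2E1MeromorphicSolutionPrinciple  -- ★ P1a: `exists_meromorphic_solution`; P1a-loc: `eventually_ne_zero_of_analyticOnNhd`, `exists_mem_ne_zero_of_isOpen`
import Summits.HodgeConjecture.HodgeConjecture.Theorems.K2E1FredholmFiniteTypeCriterion   -- ★ P1b: `locallyFiniteType_prod_of_leftInvertible_modCompact` (fred2)
import Mathlib.Analysis.Normed.Operator.Bilinear
import HarnessLib

/-!
# K2·E1 — `K2E1BLSystemAssembly`: BERNSTEIN–LAPID'S AUXILIARY HILBERT-SPACE SYSTEM `Ξ̃(z)` IS LOCALLY OF FINITE TYPE, TRANSFER TO THE `𝔛`-SYSTEM, AND THE PER-BALL ASSEMBLY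
# «unique on the Godement set + locally finite type ⟹ a scalar meromorphic continuation on the ball» [arXiv:1911.02342, §4 Claims 3–5 and p. 10] — OVER ABSTRACT LETTERS

Track B ∕ K2-LIT, crux h413 = `stmt-HodgeConjecture-24833`, route of record `HCCMUnconditional`; cell `hodgecm-mathlib`, squad K2, ENGINE E1 (campaign EIS-R7-BL-SPH-2, (ζ′) WIRING §3
P8 «P8 prep», dealer rulings 09:00:48Z ∕ 09:04:59Z: (D-i) per ball ONE system in the unknown PAIR `(ψ, b) ∈ 𝓗_k(𝔛) × ℂ`, the `Z`-side system AUXILIARY per `z₀`; (D-ii) gluing by normal form = ★ G-a).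
Prover seat `hodgecm-mathlib-K2E3-p12` (g7).  THEOREMS ONLY (no `def`, no `instance`, no notation, no named-fact hypothesis, no `sorry`); lane `--supports stmt-HodgeConjecture-24833 --as helper`
(count-neutral).  Closes no socket.  GENERIC operator theory — every space and operator is an abstract letter; P8 proper instantiates them with ★ `K2E1BLBorelSpacesU2Defs` ∕ `K2E1BLBorelOperatorsU2Defs`
(`X := HX k μ`, `V := HN k c μZ`, `V₀ := HN k c₀ μZ`, `ι := iota`, `π := piN`, `r := restrHN`, `δ := deltaShift` of the good test function `h = η ∗ η` (ruling 09:04:47Z: `T := δ(η) ∘L δ(η)` on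
`𝓗_k(𝔛)`, `ĥ = η̂²` — this file is agnostic: `T`, `ĥ` are letters), `P := cnstN`, `Q :=` the projection killing (Ξ₃), `α₁ = H^z|_{Z_c}`, `α₂ = H^{1−z}|_{Z_c}`, `Λ := ev_g ∘ δ(h)` (★ P3)).

THE MATHEMATICS [BernsteinLapid2019, §4].  Letters: `T : X →L X` (`δ(h)` on `𝓗_k(𝔛)`), `ĥ` holomorphic with `ĥ(z₀) ≠ 0`, `ι : X →L V` (`ι_{c,k}`), `r : V →L V₀` (restriction `Z_c → Z_{c₀}`),
`δ : V →L V₀` (`δ_{c,c₀}(h)`), `π : V₀ →L X` (`π_{c₀,k}`), `P : V →L V` (`cnst_{k,c}`), holomorphic `α₁, α₂ : ℂ → V`, and the two Claim-4 identities `δ ∘ ι = r ∘ ι ∘ T` (bullets 2+5: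
`δ_{c,c₀}(h)ι_c = ι_{c₀}δ(h) = (ι_c ·)|_{Z_{c₀}} ∘ δ(h)`) and `π ∘ r ∘ ι = 1` (bullet 1: `π_{c₀}ι_{c₀} = 1`), plus «`δ_{c,c₀}(h)` restricted to `𝓗^cusp = ker P` is compact» as
`IsCompactOperator (δ ∘ (1 − P))` (★ K2 + P2b).  Claim 5's system `Ξ̃(z)` on `(f, b) ∈ V × ℂ`: (11) `δf = ĥ(z)·rf`, (12) `ιπrf = f`, (ct) `Pf = φ₀α₁(z) + bα₂(z)`.
§1 **`leftInvertible_modCompact_of_blReadouts`** — B–L «(11) and (12) imply `ĥ⁻¹ιπδf = f`»: ANY operator `A₀` from which `δ − ĥ(z₀)r`, `ιπr − 1`, `P` are linear readouts is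
left-invertible modulo the compact `K = ĥ⁻¹ιπδ(1 − P)` — the `hleft` input of ★ fred2.
§2 **`finiteType_transfer`** — columns transfer along a continuous linear `Φ` when every solution of the target system is `Φ` of a solution of the source system (B–L p. 10: `Sol Ξ(s) ⊆
π(Im λ_s)`).
§3 **`locallyFiniteType_of_index`** — THE FINITE-TYPE STEP (Claim 5 + p. 10): an ABSTRACT system `A z x = c z` in `x = (ψ, b) ∈ X × ℂ` whose solutions satisfy the readouts `Tψ = ĥ(z)ψ` and
`P(ιψ) = φ₀α₁(z) + bα₂(z)` near `z₀`, with `ĥ(z₀) ≠ 0` and the letters above, satisfies ★ `exists_meromorphic_solution`'s `hfin` clause at `z₀` (internally: `Ξ̃` is holomorphic and, by §1 +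
★ fred2, locally of finite type; `(ιψ, b)` solves `Ξ̃`; push back by `Φ(f, b) = (πrf, b)`, §2).  NO differentiability of `A` is needed for this step.
§4 **`exists_meromorphicOn_scalar_of_system`** — THE PER-BALL ASSEMBLY: a holomorphic system on an open preconnected `D` with `hfin` everywhere, a known solution `e(z)` on `D ∩ O` (`O` open,
`D ∩ O ≠ ∅`), unique there wherever the holomorphic `ĥ ≢ 0` does not vanish, and a functional `Λ` with `Λ(e z) = ĥ(z)·E(z)` on `D ∩ O` ⟹ `∃ Ec` meromorphic on `D` with `Ec = E` on `O`
(★ P1a + ★ G-a scalarisation); with its vector form **`exists_meromorphic_solution_eventually`** (`v` meromorphic on `D`, eventually near every point THE solution, `= e` on `O`).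
HONEST LABEL: HC_CM is proved only modulo the 7 printed citations (2 remaining named inputs: hLiu418 = `stmt-HodgeConjecture-24832`, h413 = `stmt-HodgeConjecture-24833`) until rung 0
closes; this file asserts no named fact and closes no socket.
References: [BernsteinLapid2019] J. Bernstein, E. Lapid, *On the meromorphic continuation of Eisenstein series*, arXiv:1911.02342 (JAMS 37 (2024), doi:10.1090/jams/1020), §2.3–2.4, §4
Claims 3–5, p. 10 · [ReedSimonI1980] M. Reed, B. Simon, *Functional Analysis*, Thm. VI.13–VI.14.
-/

set_option autoImplicit false
-- the mandated namespace repeats the single-problem summit's segment (`HodgeConjecture.HodgeConjecture`)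
set_option linter.dupNamespace false

noncomputable section

open Filter Topology Set Submodule
open scoped Classical
open Summit.HodgeConjecture.HodgeConjecture.Cruxes.H413.K2E1MeromorphicSolutionPrincipleLocal (eventually_ne_zero_of_analyticOnNhd exists_mem_ne_zero_of_isOpen)
open Summit.HodgeConjecture.HodgeConjecture.Cruxes.H413.K2E1MeromorphicSolutionPrinciple (exists_meromorphic_solution)
open Summit.HodgeConjecture.HodgeConjecture.Cruxes.H413.K2E1FredholmFiniteTypeCriterion (locallyFiniteType_prod_of_leftInvertible_modCompact)
open Summit.HodgeConjecture.HodgeConjecture.Cruxes.H413.K2E1BLMeromorphicGluing (meromorphicOn_scalarisation)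

namespace Summit.HodgeConjecture.HodgeConjecture.Cruxes.H413.K2E1BLSystemAssembly

/-! ## §1 «(11) and (12) imply `ĥ⁻¹ιπδf = f`»: left-invertibility modulo compact operators from three linear readouts -/

/-- **B–L'S LEFT INVERSE MODULO COMPACTS** [BernsteinLapid2019, §4 proof of Claim 5: «since (11) and (12) imply `g(s)⁻¹ι_{c,N}π_{c₀,N}δ_{c,c₀}(h)f = f`, the claim follows by Fredholm's
criterion»].  Letters `δ r : V →L V₀`, `ι : X →L V`, `π : V₀ →L X`, `P : V →L V`, a scalar `g ≠ 0`, and `δ ∘ (1 − P)` compact.  If an operator `A₀ : V →L 𝓦` admits linear readouts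
`L₁A₀ = δ − g·r`, `L₂A₀ = ιπr − 1`, `L₃A₀ = P`, then `D₀A₀ = 1 − K` with `D₀ := T L₃ − g⁻¹ιπL₁ − L₂`, `T := g⁻¹ιπδ`, `K := T(1 − P)` compact. [cite: BernsteinLapid2019, §4 Claim 5]
[cite: ReedSimonI1980, Thm. VI.13] -/
theorem leftInvertible_modCompact_of_blReadouts {V V₀ X 𝓦 : Type*} [NormedAddCommGroup V] [NormedSpace ℂ V] [NormedAddCommGroup V₀] [NormedSpace ℂ V₀] [NormedAddCommGroup X]
    [NormedSpace ℂ X] [NormedAddCommGroup 𝓦] [NormedSpace ℂ 𝓦] (δ r : V →L[ℂ] V₀) (ι : X →L[ℂ] V) (π : V₀ →L[ℂ] X) (P : V →L[ℂ] V) {g : ℂ} (hg : g ≠ 0)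
    (hK : IsCompactOperator (δ ∘L ((1 : V →L[ℂ] V) - P))) {A₀ : V →L[ℂ] 𝓦} (L₁ : 𝓦 →L[ℂ] V₀) (L₂ L₃ : 𝓦 →L[ℂ] V) (h₁ : L₁ ∘L A₀ = δ - g • r)
    (h₂ : L₂ ∘L A₀ = ι ∘L π ∘L r - 1) (h₃ : L₃ ∘L A₀ = P) :
    ∃ (D₀ : 𝓦 →L[ℂ] V) (K : V →L[ℂ] V), IsCompactOperator K ∧ D₀ ∘L A₀ = 1 - K := by
  have e₁ : ∀ v, L₁ (A₀ v) = δ v - g • r v := fun v => by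
    have h := congrArg (fun f : V →L[ℂ] V₀ => f v) h₁; simpa using h
  have e₂ : ∀ v, L₂ (A₀ v) = ι (π (r v)) - v := fun v => by
    have h := congrArg (fun f : V →L[ℂ] V => f v) h₂; simpa using h
  have e₃ : ∀ v, L₃ (A₀ v) = P v := fun v => by
    have h := congrArg (fun f : V →L[ℂ] V => f v) h₃; simpa using h
  refine ⟨(g⁻¹ • (ι ∘L π ∘L δ)) ∘L L₃ - g⁻¹ • (ι ∘L π ∘L L₁) - L₂, g⁻¹ • ((ι ∘L π) ∘L (δ ∘L ((1 : V →L[ℂ] V) - P))), (hK.clm_comp (ι ∘L π)).smul g⁻¹, ?_⟩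
  ext v
  simp only [ContinuousLinearMap.comp_apply, sub_apply, smul_apply, one_apply_eq_self, e₁, e₂, e₃, map_sub, map_smul, smul_sub, smul_smul, inv_mul_cancel₀ hg, one_smul]
  abel

/-! ## §2 Transfer of finite type along a continuous linear map -/

/-- **TRANSFER OF FINITE TYPE** [BernsteinLapid2019, §4 p. 10 last paragraph: `Sol(Ξ(s)) ⊆ Im(δ(h)π_{c,N}λ_s)`].  Holomorphic columns `e_j` for the solutions of a source predicate `P'`
on `W`, a continuous linear `Φ`, and «every `P`-solution is `Φ` of a `P'`-solution» give the holomorphic columns `Φ ∘ e_j` for `P`. [cite: BernsteinLapid2019, §4 p. 10] -/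
theorem finiteType_transfer {𝓥 𝓥' : Type*} [NormedAddCommGroup 𝓥] [NormedSpace ℂ 𝓥] [NormedAddCommGroup 𝓥'] [NormedSpace ℂ 𝓥'] (Φ : 𝓥' →L[ℂ] 𝓥) {W : Set ℂ} {n : ℕ}
    {e : Fin n → ℂ → 𝓥'} (he : ∀ j, DifferentiableOn ℂ (e j) W) {P' : ℂ → 𝓥' → Prop} (hsol : ∀ s ∈ W, ∀ y : 𝓥', P' s y → y ∈ span ℂ (Set.range fun j => e j s))
    {P : ℂ → 𝓥 → Prop} (hmap : ∀ s ∈ W, ∀ x : 𝓥, P s x → ∃ y : 𝓥', P' s y ∧ Φ y = x) :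
    (∀ j, DifferentiableOn ℂ (fun s => Φ (e j s)) W) ∧ ∀ s ∈ W, ∀ x : 𝓥, P s x → x ∈ span ℂ (Set.range fun j => Φ (e j s)) := by
  refine ⟨fun j => Φ.differentiable.comp_differentiableOn (he j), fun s hs x hx => ?_⟩
  obtain ⟨y, hy, rfl⟩ := hmap s hs x hx
  have h2 := Submodule.mem_map_of_mem (f := (Φ : 𝓥' →ₗ[ℂ] 𝓥)) (hsol s hs y hy)
  rw [← Submodule.span_image] at h2
  refine span_mono ?_ h2
  rintro _ ⟨_, ⟨j, rfl⟩, rfl⟩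
  exact ⟨j, rfl⟩

/-! ## §3 Claim 5 + p. 10: the `𝔛`-system is locally of finite type at a point where some `ĥ` does not vanish -/

/-- **THE FINITE-TYPE STEP** [BernsteinLapid2019, §4 Claim 5 and the closing paragraph of p. 10].  ABSTRACT `𝔛`-system `A z x = c z` in `x = (ψ, b) ∈ X × ℂ` on an open `W₀ ∋ z₀`; letters
`T, ĥ, ι, P, α₁, α₂, φ₀, δ, r, π` (module docstring) with `ĥ, α₁, α₂` holomorphic on `W₀`, `ĥ(z₀) ≠ 0`, `δ ∘ ι = r ∘ ι ∘ T`, `π ∘ r ∘ ι = 1`, `δ ∘ (1 − P)` compact (`V` Hilbert); READOUTS: every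
solution satisfies `Tψ = ĥ(z)ψ` and `P(ιψ) = φ₀α₁(z) + bα₂(z)`.  THEN near `z₀` all solutions lie in the span of finitely many holomorphic columns (the `hfin` clause of ★
`exists_meromorphic_solution` at `z₀`).  Proof: `(ιψ, b)` solves Claim 5's holomorphic system `Ξ̃(z)` = (11)(12)(ct) on `V × ℂ`, which is locally of finite type by §1 + ★ fred2 (the
`ℂ`-component trivially of finite type); push the columns back by `Φ(f, b) := (πrf, b)` (§2).  `A` itself need not be holomorphic for this step. [cite: BernsteinLapid2019, §4 Claim 5 and p. 10]
[cite: ReedSimonI1980, Thm. VI.13] -/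
theorem locallyFiniteType_of_index {X V V₀ 𝓦 : Type*} [NormedAddCommGroup X] [NormedSpace ℂ X] [NormedAddCommGroup V] [InnerProductSpace ℂ V] [CompleteSpace V] [NormedAddCommGroup V₀]
    [NormedSpace ℂ V₀] [NormedAddCommGroup 𝓦] [NormedSpace ℂ 𝓦] {W₀ : Set ℂ} (hW₀ : IsOpen W₀) {z₀ : ℂ} (hz₀ : z₀ ∈ W₀) {A : ℂ → (X × ℂ) →L[ℂ] 𝓦} {c : ℂ → 𝓦} (T : X →L[ℂ] X)
    {ĥ : ℂ → ℂ} (hĥ : DifferentiableOn ℂ ĥ W₀) (hĥ₀ : ĥ z₀ ≠ 0) (ι : X →L[ℂ] V) (P : V →L[ℂ] V) {α₁ α₂ : ℂ → V} (hα₁ : DifferentiableOn ℂ α₁ W₀) (hα₂ : DifferentiableOn ℂ α₂ W₀)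
    (φ₀ : ℂ) (δ r : V →L[ℂ] V₀) (π : V₀ →L[ℂ] X) (hδι : δ ∘L ι = r ∘L ι ∘L T) (hπ : π ∘L r ∘L ι = ContinuousLinearMap.id ℂ X)
    (hK : IsCompactOperator (δ ∘L ((1 : V →L[ℂ] V) - P))) (hsolT : ∀ z ∈ W₀, ∀ x : X × ℂ, A z x = c z → T x.1 = ĥ z • x.1)
    (hsolC : ∀ z ∈ W₀, ∀ x : X × ℂ, A z x = c z → P (ι x.1) = φ₀ • α₁ z + x.2 • α₂ z) :
    ∃ W ∈ 𝓝 z₀, ∃ n : ℕ, ∃ e : Fin n → ℂ → X × ℂ, (∀ j, DifferentiableOn ℂ (e j) W) ∧ ∀ z ∈ W, ∀ x : X × ℂ, A z x = c z → x ∈ span ℂ (Set.range fun j => e j z) := by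
  -- Claim 5's system `Ξ̃(z)` on `V × ℂ`, valued in `V₀ × (V × V)`: (11) | (12) | (ct)
  obtain ⟨J₁, hJ₁⟩ : ∃ J₁ : V₀ →L[ℂ] V₀ × (V × V), J₁ = ContinuousLinearMap.inl ℂ V₀ (V × V) := ⟨_, rfl⟩
  obtain ⟨J₂, hJ₂⟩ : ∃ J₂ : V →L[ℂ] V₀ × (V × V), J₂ = ContinuousLinearMap.inr ℂ V₀ (V × V) ∘L ContinuousLinearMap.inl ℂ V V := ⟨_, rfl⟩
  obtain ⟨J₃, hJ₃⟩ : ∃ J₃ : V →L[ℂ] V₀ × (V × V), J₃ = ContinuousLinearMap.inr ℂ V₀ (V × V) ∘L ContinuousLinearMap.inr ℂ V V := ⟨_, rfl⟩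
  have hJ₁a : ∀ w, J₁ w = (w, (0, 0)) := fun w => by rw [hJ₁]; rfl
  have hJ₂a : ∀ v, J₂ v = (0, (v, 0)) := fun v => by rw [hJ₂]; rfl
  have hJ₃a : ∀ v, J₃ v = (0, (0, v)) := fun v => by rw [hJ₃]; rfl
  obtain ⟨AZ, hAZ⟩ : ∃ AZ : ℂ → (V × ℂ) →L[ℂ] V₀ × (V × V), AZ = fun z =>
      J₁ ∘L ((δ - ĥ z • r) ∘L ContinuousLinearMap.fst ℂ V ℂ) + J₂ ∘L ((ι ∘L π ∘L r - 1) ∘L ContinuousLinearMap.fst ℂ V ℂ) +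
        J₃ ∘L (P ∘L ContinuousLinearMap.fst ℂ V ℂ - (ContinuousLinearMap.snd ℂ V ℂ).smulRight (α₂ z)) := ⟨_, rfl⟩
  obtain ⟨cZ, hcZ⟩ : ∃ cZ : ℂ → V₀ × (V × V), cZ = fun z => J₃ (φ₀ • α₁ z) := ⟨_, rfl⟩
  have hAZa : ∀ z (f : V) (b : ℂ), AZ z (f, b) = (δ f - ĥ z • r f, (ι (π (r f)) - f, P f - b • α₂ z)) := fun z f b => by
    rw [hAZ]
    simp only [add_apply, ContinuousLinearMap.comp_apply, ContinuousLinearMap.coe_fst', sub_apply, smul_apply, one_apply_eq_self, ContinuousLinearMap.smulRight_apply,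
      ContinuousLinearMap.coe_snd', hJ₁a, hJ₂a, hJ₃a, Prod.mk_add_mk, add_zero, zero_add]
  have hcZa : ∀ z, cZ z = (0, (0, φ₀ • α₁ z)) := fun z => by rw [hcZ]; exact hJ₃a _
  -- `Ξ̃` is holomorphic
  have hsR : DifferentiableOn ℂ (fun z => (ContinuousLinearMap.snd ℂ V ℂ).smulRight (α₂ z)) W₀ := by
    have h := (ContinuousLinearMap.smulRightL ℂ (V × ℂ) V (ContinuousLinearMap.snd ℂ V ℂ)).differentiable.comp_differentiableOn hα₂
    refine h.congr fun z _ => ContinuousLinearMap.ext fun x => ?_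
    simp only [Function.comp_apply, ContinuousLinearMap.smulRightL_apply_apply, ContinuousLinearMap.smulRight_apply]
  have hAZd : DifferentiableOn ℂ AZ W₀ := by
    rw [hAZ]
    exact ((((differentiableOn_const J₁).clm_comp (((differentiableOn_const δ).sub (hĥ.smul (differentiableOn_const r))).clm_comp (differentiableOn_const _))).add
      ((differentiableOn_const J₂).clm_comp (differentiableOn_const _))).add ((differentiableOn_const J₃).clm_comp ((differentiableOn_const _).sub hsR)))
  have hcZd : DifferentiableOn ℂ cZ W₀ := by
    rw [hcZ]
    exact J₃.differentiable.comp_differentiableOn (hα₁.const_smul φ₀)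
  -- left inverse modulo compacts at `z₀` (§1 with the readouts `fst`, `fst ∘ snd`, `snd ∘ snd`)
  have hleft : ∃ (D₀ : V₀ × (V × V) →L[ℂ] V) (K : V →L[ℂ] V), IsCompactOperator K ∧ D₀ ∘L ((AZ z₀) ∘L ContinuousLinearMap.inl ℂ V ℂ) = 1 - K := by
    refine leftInvertible_modCompact_of_blReadouts δ r ι π P hĥ₀ hK (ContinuousLinearMap.fst ℂ V₀ (V × V)) (ContinuousLinearMap.fst ℂ V V ∘L ContinuousLinearMap.snd ℂ V₀ (V × V))
      (ContinuousLinearMap.snd ℂ V V ∘L ContinuousLinearMap.snd ℂ V₀ (V × V)) ?_ ?_ ?_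
    · ext f; simp only [ContinuousLinearMap.comp_apply, ContinuousLinearMap.inl_apply, hAZa, ContinuousLinearMap.coe_fst', sub_apply, smul_apply]
    · ext f; simp only [ContinuousLinearMap.comp_apply, ContinuousLinearMap.inl_apply, hAZa, ContinuousLinearMap.coe_fst', ContinuousLinearMap.coe_snd', sub_apply, one_apply_eq_self]
    · ext f; simp only [ContinuousLinearMap.comp_apply, ContinuousLinearMap.inl_apply, hAZa, ContinuousLinearMap.coe_snd', zero_smul, sub_zero]
  -- the `ℂ`-component is trivially of finite type (one constant column)
  have hfin₂ : ∀ z ∈ W₀, ∀ x : V × ℂ, AZ z x = cZ z → x.2 ∈ span ℂ (Set.range fun _ : Fin 1 => (1 : ℂ)) := fun z _ x _ => by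
    rw [show x.2 = x.2 • (1 : ℂ) from (mul_one _).symm]
    exact Submodule.smul_mem _ _ (subset_span ⟨0, rfl⟩)
  obtain ⟨W, hW, n, e, he, hsolZ⟩ := locallyFiniteType_prod_of_leftInvertible_modCompact hW₀ hz₀ hAZd hcZd hleft (τ := fun _ : Fin 1 => fun _ : ℂ => (1 : ℂ))
    (fun _ => differentiableOn_const _) hfin₂
  -- transfer back to `X × ℂ` along `Φ(f, b) = (πrf, b)`
  have hπa : ∀ ψ : X, π (r (ι ψ)) = ψ := fun ψ => by
    have h := congrArg (fun f : X →L[ℂ] X => f ψ) hπ; simpa using h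
  have hδιa : ∀ ψ : X, δ (ι ψ) = r (ι (T ψ)) := fun ψ => by
    have h := congrArg (fun f : X →L[ℂ] V₀ => f ψ) hδι; simpa using h
  obtain ⟨he', hsol'⟩ := finiteType_transfer ((π ∘L r).prodMap (ContinuousLinearMap.id ℂ ℂ)) (W := W ∩ W₀) (fun j => (he j).mono Set.inter_subset_left)
    (P' := fun z y => AZ z y = cZ z) (fun z hz y hy => hsolZ z hz.1 y hy) (P := fun z x => A z x = c z) fun z hz x hx => by
      refine ⟨(ι x.1, x.2), ?_, ?_⟩
      · rw [hAZa, hcZa, hδιa, hsolT z hz.2 x hx, hsolC z hz.2 x hx, hπa, map_smul, map_smul, sub_self, sub_self, add_sub_cancel_right]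
      · show (π (r (ι x.1)), x.2) = x
        rw [hπa]
  exact ⟨W ∩ W₀, inter_mem hW (hW₀.mem_nhds hz₀), n, _, he', hsol'⟩

/-! ## §4 The per-ball assembly: uniqueness on the Godement set + finite type ⟹ a scalar meromorphic continuation -/

/-- **VECTOR FORM** [BernsteinLapid2019, Thm 2.3 as consumed in §4]: under the hypotheses of ★ `exists_meromorphic_solution` there is `v : ℂ → 𝓥` meromorphic on `D` which, near EVERY point
of `D`, is eventually (punctured neighbourhood) THE unique solution: `∀ w, A z w = c z ↔ w = v z`. [cite: BernsteinLapid2019, Thm 2.3] [cite: ReedSimonI1980, Thm. VI.14] -/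
theorem exists_meromorphic_solution_eventually {𝓥 𝓦 : Type*} [NormedAddCommGroup 𝓥] [NormedSpace ℂ 𝓥] [CompleteSpace 𝓥] [NormedAddCommGroup 𝓦] [NormedSpace ℂ 𝓦] [CompleteSpace 𝓦]
    {D : Set ℂ} (hD : IsOpen D) (hDc : IsPreconnected D) {A : ℂ → 𝓥 →L[ℂ] 𝓦} (hA : DifferentiableOn ℂ A D) {c : ℂ → 𝓦} (hc : DifferentiableOn ℂ c D)
    (hfin : ∀ s₀ ∈ D, ∃ W ∈ 𝓝 s₀, ∃ n : ℕ, ∃ e : Fin n → ℂ → 𝓥, (∀ j, DifferentiableOn ℂ (e j) W) ∧ ∀ s ∈ W, ∀ v : 𝓥, A s v = c s → v ∈ span ℂ (Set.range fun j => e j s))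
    (hunq : ∃ U₀ : Set ℂ, IsOpen U₀ ∧ U₀.Nonempty ∧ U₀ ⊆ D ∧ ∀ s ∈ U₀, ∃! v : 𝓥, A s v = c s) :
    ∃ v : ℂ → 𝓥, MeromorphicOn v D ∧ ∀ z₀ ∈ D, ∀ᶠ z in 𝓝[≠] z₀, ∀ w : 𝓥, A z w = c z ↔ w = v z := by
  obtain ⟨v, U, -, -, -, -, hsolU, hmer, hloc⟩ := exists_meromorphic_solution hD hDc hA hc hfin hunq
  refine ⟨v, hmer, fun z₀ hz₀ => ?_⟩
  obtain ⟨W, hW, f, u, -, -, hfne, hfU⟩ := hloc z₀ hz₀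
  filter_upwards [hfne, mem_nhdsWithin_of_mem_nhds hW] with z hz hzW
  exact hsolU z (hfU z hzW hz).1

/-- **THE PER-BALL ASSEMBLY** [BernsteinLapid2019, §4 p. 10 with Thm 2.3 and §2.1].  `D` open preconnected, a holomorphic system `A z w = c z` (Banach `𝓥 → 𝓦`) with the `hfin` clause at
every point of `D` (§3 per index), `O` open with `D ∩ O ≠ ∅` (the Godement set), a holomorphic `ĥ` on `D` not identically zero, a KNOWN solution `e(z)` for `z ∈ D ∩ O` (★ P7) which is THE
solution wherever `ĥ(z) ≠ 0` (★ P6 via P3), and a functional `Λ ∈ 𝓥'` with `Λ(e z) = ĥ(z)·E(z)` on `D ∩ O` (★ P5: `δ(h)E = ĥE`, `Λ = ev_g ∘ δ(h)`).  THEN `∃ Ec : ℂ → ℂ` meromorphic on `D`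
with `Ec = E` on ALL of `O`.  (`Ec := if z ∈ O then E z else ĥ(z)⁻¹Λ(v z)`, `v` from `exists_meromorphic_solution_eventually`; ★ G-a `meromorphicOn_scalarisation`.)
[cite: BernsteinLapid2019, §4 p. 10] [cite: ReedSimonI1980, Thm. VI.14] -/
theorem exists_meromorphicOn_scalar_of_system {𝓥 𝓦 : Type*} [NormedAddCommGroup 𝓥] [NormedSpace ℂ 𝓥] [CompleteSpace 𝓥] [NormedAddCommGroup 𝓦] [NormedSpace ℂ 𝓦] [CompleteSpace 𝓦]
    {D : Set ℂ} (hD : IsOpen D) (hDc : IsPreconnected D) {A : ℂ → 𝓥 →L[ℂ] 𝓦} (hA : DifferentiableOn ℂ A D) {c : ℂ → 𝓦} (hc : DifferentiableOn ℂ c D)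
    (hfin : ∀ s₀ ∈ D, ∃ W ∈ 𝓝 s₀, ∃ n : ℕ, ∃ e : Fin n → ℂ → 𝓥, (∀ j, DifferentiableOn ℂ (e j) W) ∧ ∀ s ∈ W, ∀ v : 𝓥, A s v = c s → v ∈ span ℂ (Set.range fun j => e j s))
    {O : Set ℂ} (hO : IsOpen O) (hDO : (D ∩ O).Nonempty) {ĥ : ℂ → ℂ} (hĥ : DifferentiableOn ℂ ĥ D) (hĥne : ∃ z ∈ D, ĥ z ≠ 0) {e : ℂ → 𝓥}
    (hsol : ∀ z ∈ D ∩ O, A z (e z) = c z) (hunq : ∀ z ∈ D ∩ O, ĥ z ≠ 0 → ∀ w : 𝓥, A z w = c z → w = e z) (Λ : 𝓥 →L[ℂ] ℂ) {E : ℂ → ℂ}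
    (hΛ : ∀ z ∈ D ∩ O, Λ (e z) = ĥ z * E z) :
    ∃ Ec : ℂ → ℂ, MeromorphicOn Ec D ∧ ∀ z ∈ O, Ec z = E z := by
  have hĥa : AnalyticOnNhd ℂ ĥ D := hĥ.analyticOnNhd hD
  obtain ⟨z₁, hz₁, hĥ₁⟩ := hĥne
  -- uniqueness on the open non-empty `U₀ := (D ∩ {ĥ ≠ 0}) ∩ O`
  have hU₀o : IsOpen ((D ∩ ĥ ⁻¹' {w | w ≠ 0}) ∩ O) := (hĥ.continuousOn.isOpen_inter_preimage hD isOpen_ne).inter hO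
  obtain ⟨z₂, hz₂, hĥ₂⟩ := exists_mem_ne_zero_of_isOpen hDc hĥa hz₁ hĥ₁ (hD.inter hO) Set.inter_subset_left hDO
  have hunq' : ∃ U₀ : Set ℂ, IsOpen U₀ ∧ U₀.Nonempty ∧ U₀ ⊆ D ∧ ∀ s ∈ U₀, ∃! v : 𝓥, A s v = c s :=
    ⟨(D ∩ ĥ ⁻¹' {w | w ≠ 0}) ∩ O, hU₀o, ⟨z₂, ⟨hz₂.1, hĥ₂⟩, hz₂.2⟩, fun s hs => hs.1.1, fun s hs =>
      ⟨e s, hsol s ⟨hs.1.1, hs.2⟩, fun w hw => hunq s ⟨hs.1.1, hs.2⟩ hs.1.2 w hw⟩⟩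
  obtain ⟨v, hv, hev⟩ := exists_meromorphic_solution_eventually hD hDc hA hc hfin hunq'
  refine ⟨fun z => if z ∈ O then E z else (ĥ z)⁻¹ * Λ (v z), meromorphicOn_scalarisation hv Λ hĥa.meromorphicOn E fun z₀ hz₀ => ?_, fun z hz => by simp only [if_pos hz]⟩
  filter_upwards [hev z₀ hz₀, eventually_ne_zero_of_analyticOnNhd hDc hĥa hz₁ hĥ₁ hz₀, mem_nhdsWithin_of_mem_nhds (hD.mem_nhds hz₀)] with z hz hĥz hzD
  intro hzO
  have hvz : e z = v z := (hz (e z)).1 (hsol z ⟨hzD, hzO⟩)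
  exact ⟨hĥz, by rw [← hvz, hΛ z ⟨hzD, hzO⟩]⟩

end Summit.HodgeConjecture.HodgeConjecture.Cruxes.H413.K2E1BLSystemAssembly

end
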